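import Summits.QuantumFields.YangMills.Theorems.FlatTubeReductionCoreDefectRecordOrbitMomentsQuasi
import Summits.QuantumFields.YangMills.Theorems.FlatTubeReductionSlowSideFibreFactors
import Summits.QuantumFields.YangMills.Theorems.FlatTubeReductionRecordFibreFactor
import Summits.QuantumFields.YangMills.Theorems.FlatTubeReductionRecordReferenceMassRatio
import Summits.QuantumFields.YangMills.Theorems.FlatTubeReductionCoreDefectPotBookkeeping
import Summits.QuantumFields.YangMills.Theorems.FlatTubeReductionCoreCurrencyPot
import Summits.QuantumFields.YangMills.Theorems.FlatTubeReductionSplitRhsBound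
import Summits.QuantumFields.YangMills.Theorems.FlatTubeReductionCoreRateConstants
import Summits.QuantumFields.YangMills.Theorems.FlatTubeReductionRecordNormFloor
import Summits.QuantumFields.YangMills.Theorems.LuscherReductionTwistedTraceScalingBODefectCoreRecord
import Summits.QuantumFields.YangMills.Theorems.LuscherReductionTwistedTraceScalingBODefectShellRate
import Summits.QuantumFields.YangMills.Theorems.LuscherReductionTwistedTraceScalingBORecordGamma
import Summits.QuantumFields.YangMills.Theorems.LuscherReductionDressedRitzPolyakovLiftShadowKernelMoment
import Summits.QuantumFields.YangMills.Theorems.LuscherReductionTwistedTraceScalingBODefectRateAlgebra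
import HarnessLib

/-!
# ★★★ THE CORE PIECE OF `stub_hODpot_A` IN THE STUB'S CURRENCY: `∫𝟙_{S_in}E_core²w ≤ Λ_A²·(C_b(η² + β^{-2/3})·T + κ_A·γ·∫od²φ²)`

Support file for the crux `NearFlatRatioLaw` (line `ratepack_v2`, stub `stub_hODpot_A`; successor steps (A)–(C) of
`Cruxes/NearFlatRatioLaw/Lines/ratepack-v7-moments-g18.md` §14 ASSEMBLED; memo v8 (g19)).

★★★ `core_defect_pot_currency` — at the rate twin's scales (`s = 1/6`, cap constant `K_c = 42D + 1`, amplitude window `orbitDist < D·recordDelta1 L (1/6) β`,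
`0 ≤ D ≤ |Λ|`, output window `orbitDist(slowMean) ≤ D_O·β^{-1/6}`), for a CENTRAL QUASIMODE `(c₁, η)` (hypothesis `hquasi`, as in `…CoreDefectRecordOrbitMomentsQuasi`;
`η ≤ 1/2` eventually): there is `M₀` and, for `M ≥ M₀`, `D_O ≥ 0`, β-INDEPENDENT constants `C_b, κ_A ≥ 0` with, eventually in `β`, for every bounded measurable `φ` in the
window, `∫ 𝟙_{S_in}(K_core/w − ψ_φ⊗Ω_c)²w ≤ Λ_A(β)²·(C_b·(η(β)² + β^{-2/3})·T(φ⊗Ω_c) + κ_A·γ(β)·∫orbitDist²φ²)`,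
`Λ_A = (btC/fpZ/γ)·λ₀(L³β)` (the stub's `Λ_A`), `T = tubeNormSq (softWeight χ) (boFun φ Ω_c)`, `Ω_c = recordProfile L β`.
Chain: `defect_core_sq_record_orbit_moments_quasi` (R4a-K′) → `integral_outputWeight_mul_slow_side_le_fibre_factors` (A) → `record_fibre_factor_le_reference_mass` ×7 +
`record_reweighted_reference_mass_le_btC` + `slow_coeff_bound_phi/psi` (B) via `split_rhs_bound` → `core_currency_pot` (C) with `btC_floor_of_quasimode_eta`,
`tubeNormSq_record_ge_R`, `recordGamma_le_two_mul_inner`, `exists_linkCE_le_two_mul_levelValue_zero`, `sq_integral_slowPa_le` → `core_rate_consts_le`.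
WHAT REMAINS of `stub_hODpot_A` after this file: (D) a central quasimode with `η² = O(bareLambda(L³β)²)` (the record `…central_quasimode_rate` has `η = β^{-1/5}`,
insufficient); (E) the K-generic non-core pieces (FP tail, outer, dual-BO shell), the kernel split and the `hOD`-door with potential — bookkeeping ports of lane A.
HONEST FRAMING: helper toward a stub of a child of the CONDITIONAL route R2b1 (RECORD rung); not infinite volume, not a gap, not Clay.  No summit statement is proved.
-/

set_option autoImplicit false

noncomputable section

open MeasureTheory Filter Topology Real
open scoped BigOperators
open Literature.MathematicalPhysics.QuantumFieldTheory
open Literature.MathematicalPhysics.QuantumLattice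

namespace Summit.QuantumFields.YangMills.Theorems.FemtoTransferGap.TwoLattice.ConstTube

open Summit.QuantumFields.YangMills.Theorems.FemtoTransferGap
open Summit.QuantumFields.YangMills.Theorems.FemtoTransferGap.TwoLattice
open Summit.QuantumFields.YangMills.Theorems.FemtoTransferGap.TwoLattice.Avg
open Summit.QuantumFields.YangMills.Theorems.FemtoTransferGap.TwoLattice.Stiff
open Summit.QuantumFields.YangMills.Theorems.FemtoTransferGap.TwoLattice.GnChart
open Summit.QuantumFields.YangMills.Theorems.FemtoTransferGap.RateTube

variable {L : ℕ} [NeZero L]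

set_option maxRecDepth 4096 in
set_option maxHeartbeats 8000000 in
-- the assembly of ten landed bricks with 10–30 kB record expressions.
/-- ★★★ **THE CORE PIECE OF `stub_hODpot_A` IN THE STUB'S CURRENCY** (see the module docstring). [cite: Luscher1983, §3] [cite: SjostrandZworski2007, §2] -/
theorem core_defect_pot_currency (hLz : Nonempty (NzSite L)) (hL2 : 2 ≤ L) {D : ℝ} (hD0 : 0 ≤ D) (hDΛ : D ≤ Fintype.card (Site 3 L))
    {c₁ η : ℝ → ℝ}
    (hquasi : ∀ᶠ β : ℝ in atTop, 0 < c₁ β ∧ 0 ≤ η β ∧ ∀ v' : Edge 3 L → Fin 3 → ℝ, v' ∈ capBalancedSet L →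
      (∀ (e : Edge 3 L) (c : Fin 3), |v' e c| ≤ (9 * (L : ℝ) * (5 * (powScale (1 / 2) β * btLog β ^ 2)) + (powScale 1 β))) → ‖linkEmbed L v'‖ ≤ (min (1 / 40) (powScale (1 / 2) β * btLog β)) / 12 →
      |fpFibreTransfer L β (fun x : LinkSpace L => {x : LinkSpace L | linkCurry x ∈ capBalancedSet L}.indicator (fun _ => (1 : ℝ)) x * frozenProfile L (fun β' => stiffGaussExp L (β' / 2) β') (fun β' => min (1 / 40) (powScale (1 / 2) β' * btLog β')) β x) (coreWeight L (powScale 1 β) (5 * (powScale (1 / 2) β * btLog β ^ 2))) (orthoTube L 1 v') 1 - c₁ β * ((stiffGaussTop L (β / 2) β * Real.exp (-stiffGaussExp L (β / 2) β (linkEmbed L v'))) / (∫ u, ({u : GaugeConfig 3 1 SU2 | (∀ k : Fin 3, ‖su2Quat (u (0, k)) - 1‖ ≤ (powScale (1 / 3) β)) ∧ (L : ℝ) ^ 3 * wilsonAction su2Rep u ≤ (powScale (1 / 2) β)}.indicator (fun _ => (1 : ℝ))) u * (transferKernel su2Rep ((L : ℝ) ^ 3 * β) (1 : GaugeConfig 3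 1 SU2) u / transferKernel su2Rep ((L : ℝ) ^ 3 * β) (1 : GaugeConfig 3 1 SU2) 1) ∂configMeasure SU2 1))| ≤ η β * (c₁ β * ((stiffGaussTop L (β / 2) β * Real.exp (-stiffGaussExp L (β / 2) β (linkEmbed L v'))) / (∫ u, ({u : GaugeConfig 3 1 SU2 | (∀ k : Fin 3, ‖su2Quat (u (0, k)) - 1‖ ≤ (powScale (1 / 3) β)) ∧ (L : ℝ) ^ 3 * wilsonAction su2Rep u ≤ (powScale (1 / 2) β)}.indicator (fun _ => (1 : ℝ))) u * (transferKernel su2Rep ((L : ℝ) ^ 3 * β) (1 : GaugeConfig 3 1 SU2) u / transferKernel su2Rep ((L : ℝ) ^ 3 * β) (1 : GaugeConfig 3 1 SU2) 1) ∂configMeasure SU2 1))))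
    (hηs : ∀ᶠ β : ℝ in atTop, η β ≤ 1 / 2) :
    ∃ M₀ : ℝ, 2 ≤ M₀ ∧ ∀ M : ℝ, M₀ ≤ M → ∀ DO : ℝ, 0 ≤ DO → ∃ Cb κA : ℝ, 0 ≤ Cb ∧ 0 ≤ κA ∧ ∀ᶠ β : ℝ in atTop,
      ∀ φ : GaugeConfig 3 1 SU2 → ℝ, Measurable φ → ∀ Cφ : ℝ, (∀ u, |φ u| ≤ Cφ) → (∀ u, φ u ≠ 0 → orbitDist u < D * recordDelta1 L (1 / 6) β) →
    ∫ U, {U : GaugeConfig 3 L SU2 | U ∈ orthoTubeSet L ∧ (recordChi L (1 / 6) (42 * D + 1) M β) U ≠ 0 ∧ ‖relLinkVec L U‖ ≤ ((min (1 / 40) (powScale (1 / 2) β * btLog β)) / 12) ∧ slowMean L U ∈ {u : GaugeConfig 3 1 SU2 | orbitDist u ≤ (DO * powScale (1 / 6) β)}}.indicator (fun _ => (1 : ℝ)) U *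
        ((((fpZ (powScale 1 β))⁻¹ * ∫ w, φ w * (∫ c, fpFibreTransfer L β (fun x : LinkSpace L => {x : LinkSpace L | linkCurry x ∈ capBalancedSet L}.indicator (fun _ => (1 : ℝ)) x * frozenProfile L (fun β' => stiffGaussExp L (β' / 2) β') (fun β' => min (1 / 40) (powScale (1 / 2) β' * btLog β')) β x) (coreWeight L (powScale 1 β) (5 * (powScale (1 / 2) β * btLog β ^ 2))) (gaugeTransform (fun _ : Site 3 L => c⁻¹) U) w ∂haarProbability SU2) ∂configMeasure SU2 1) / softWeight (recordChi L (1 / 6) (42 * D + 1) M β) U -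
            boFun L (fun u' => (fpZ (powScale 1 β))⁻¹ * (c₁ β * (stiffGaussTop L (β / 2) β / (∫ u, ({u : GaugeConfig 3 1 SU2 | (∀ k : Fin 3, ‖su2Quat (u (0, k)) - 1‖ ≤ (powScale (1 / 3) β)) ∧ (L : ℝ) ^ 3 * wilsonAction su2Rep u ≤ (powScale (1 / 2) β)}.indicator (fun _ => (1 : ℝ))) u * (transferKernel su2Rep ((L : ℝ) ^ 3 * β) (1 : GaugeConfig 3 1 SU2) u / transferKernel su2Rep ((L : ℝ) ^ 3 * β) (1 : GaugeConfig 3 1 SU2) 1) ∂configMeasure SU2 1))) / fpWeightBar L (powScale 1 β) * (∫ w, φ w * (avgKernel ((L : ℝ) ^ 3 * β) u' w / transferKernel su2Rep ((L : ℝ) ^ 3 * β) (1 : GaugeConfig 3 1 SU2) 1) ∂configMeasure SU2 1))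
              (fun x : LinkSpace L => {x : LinkSpace L | linkCurry x ∈ capBalancedSet L}.indicator (fun _ => (1 : ℝ)) x * frozenProfile L (fun β' => stiffGaussExp L (β' / 2) β') (fun β' => min (1 / 40) (powScale (1 / 2) β' * btLog β')) β x) U) ^ 2 *
          softWeight (recordChi L (1 / 6) (42 * D + 1) M β) U) ∂configMeasure SU2 L ≤
      (btC L β (recordProfile L β) (btEps β) (5 * (powScale (1 / 2) β * btLog β ^ 2)) / fpZ (btEps β) / recordGamma L (recordProfile L) β * levelValue su2Rep 1 ((L : ℝ) ^ 3 * β) 0) ^ 2 *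
        (Cb * (η β ^ 2 + powScale (2 / 3) β) * tubeNormSq (softWeight (recordChi L (1 / 6) (42 * D + 1) M β)) (boFun L φ (recordProfile L β)) +
          κA * (recordGamma L (recordProfile L) β * ∫ u, orbitDist u ^ 2 * φ u ^ 2 ∂configMeasure SU2 1)) := by
  haveI := isFiniteMeasure_orthoTransverse L
  have hKc : (1 : ℝ) ≤ 42 * D + 1 := by linarith
  have hN : (0 : ℝ) < Fintype.card (Site 3 L) := by exact_mod_cast Fintype.card_pos
  -- the bricks' constants
  obtain ⟨M₁, hM₁2, hR4⟩ := defect_core_sq_record_orbit_moments_quasi (L := L) hLz (s := 1 / 6) (by norm_num) (by norm_num) hKc hquasi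
  obtain ⟨M₂, hM₂2, hNF⟩ := tubeNormSq_record_ge_R (L := L) hLz hD0
  obtain ⟨Ξ, β₄, hΞ0, hFF⟩ := record_fibre_factor_le_reference_mass L hL2
  obtain ⟨Cr, β₆, hCr0, hRR⟩ := record_reweighted_reference_mass_le_btC L hL2
  obtain ⟨B₀, hB₀, hCE⟩ := PolyakovLift.exists_linkCE_le_two_mul_levelValue_zero
  refine ⟨max M₁ M₂, hM₁2.trans (le_max_left _ _), fun M hM DO hDO => ?_⟩
  have hMM1 : M₁ ≤ M := (le_max_left _ _).trans hM
  have hMM2 : M₂ ≤ M := (le_max_right _ _).trans hM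
  obtain ⟨Cp, hCp0, hcoreE⟩ := hR4 M hMM1 DO hDO
  have hnormE := hNF M hMM2
  -- the β-independent constants
  refine ⟨7680 * Ξ * Cr * (44 * (4 + Real.sqrt (8 * (Fintype.card (Plaquette 3 1) : ℝ) * (L : ℝ) ^ 3)) ^ 2 * (300000000 * ((Fintype.card (Edge 3 L) : ℝ) + (Fintype.card (Plaquette 3 L × Fin 3) : ℝ) + (Fintype.card (Plaquette 3 L) : ℝ))) ^ 2 * (288000 * Real.exp 3) + 88 * (4 + Real.sqrt (8 * (Fintype.card (Plaquette 3 1) : ℝ) * (L : ℝ) ^ 3)) ^ 2 * (300000000 * ((Fintype.card (Edge 3 L) : ℝ) + (Fintype.card (Plaquette 3 L × Fin 3) : ℝ) + (Fintype.card (Plaquette 3 L) : ℝ))) ^ 2 * 117 + 14 * (216 * (Fintype.card (Site 3 L) : ℝ)) ^ 2 * DO ^ 2 * (288000 * Real.exp 3) + 16 * (216 * (Fintype.card (Site 3 L) : ℝ)) ^ 2 * (288000 * Real.exp 3) * 117 + 4 * (216 * (Fintype.card (Site 3 L) : ℝ)) ^ 2 * (288000 * Real.exp 3) ^ 2 + 5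 * (300000000 * ((Fintype.card (Edge 3 L) : ℝ) + (Fintype.card (Plaquette 3 L × Fin 3) : ℝ) + (Fintype.card (Plaquette 3 L) : ℝ))) ^ 2 + 28 * (216 * (Fintype.card (Site 3 L) : ℝ)) ^ 2 * DO ^ 2 * 117 + 16 * (216 * (Fintype.card (Site 3 L) : ℝ)) ^ 2 * 117 ^ 2 + 360 * (300000000 * ((Fintype.card (Edge 3 L) : ℝ) + (Fintype.card (Plaquette 3 L × Fin 3) : ℝ) + (Fintype.card (Plaquette 3 L) : ℝ))) ^ 2) + 256 * Cp ^ 2 * (42 * D + 1) ^ 4 + 1024, 3840 * Ξ * Cr * (72 * (4 + Real.sqrt (8 * (Fintype.card (Plaquette 3 1) : ℝ) * (L : ℝ) ^ 3)) ^ 2 * (300000000 * ((Fintype.card (Edge 3 L) : ℝ) + (Fintype.card (Plaquette 3 L × Fin 3) : ℝ) + (Fintype.card (Plaquette 3 L) : ℝ))) ^ 2 + 8 * (216 * (Fintype.card (Site 3 L) : ℝ)) ^ 2 * (288000 * Real.exp 3) + 28 * (216 * (Fintype.card (Site 3 L) : ℝ)) ^ 2 * DO ^ 2 + 16 * (216 *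 (Fintype.card (Site 3 L) : ℝ)) ^ 2 * 117), by positivity, by positivity, ?_⟩
  -- eventual scalar facts
  have hκP : ∀ᶠ β : ℝ in atTop, Cp * ((42 * D + 1) * powScale (1 / 6) β) ^ 2 ≤ 1 / 2 := by
    have h := ((tendsto_powScale (σ := 1 / 6) (by norm_num)).const_mul (42 * D + 1)).pow 2 |>.const_mul Cp
    rw [mul_zero, zero_pow two_ne_zero, mul_zero] at h
    exact h.eventually (eventually_le_nhds (by norm_num))
  filter_upwards [hcoreE, hnormE, hquasi, hηs, hκP, recordGamma_le_two_mul_inner (L := L) hL2, inner_mass_poly_floor (L := L),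
    eventually_ge_atTop (max (max β₄ β₆) (max 1 B₀)), eventually_ge_atTop (2 / rStar ^ 3)]
    with β hco hno hQ hη2 hκP2 hγ2 hM2fl hβmax hβr φ hφm Cφ hφb hφs
  obtain ⟨hc₁, hκP1, hcoreβ⟩ := hco
  obtain ⟨-, hη0, hquasiβ⟩ := hQ
  have hβ4 : β₄ ≤ β := (le_max_left _ _).trans ((le_max_left _ _).trans hβmax)
  have hβ6 : β₆ ≤ β := (le_max_right _ _).trans ((le_max_left _ _).trans hβmax)
  have hβ1 : 1 ≤ β := (le_max_left _ _).trans ((le_max_right _ _).trans hβmax)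
  have hβB : B₀ ≤ β := (le_max_right _ _).trans ((le_max_right _ _).trans hβmax)
  have hβ0 : 0 < β := by linarith
  have hL1 : (1 : ℝ) ≤ L := by exact_mod_cast NeZero.one_le
  have hL3 : (1 : ℝ) ≤ (L : ℝ) ^ 3 := one_le_pow₀ hL1
  have hB1 : 1 ≤ ((L : ℝ) ^ 3 * β) := by nlinarith
  have hBβ : β ≤ ((L : ℝ) ^ 3 * β) := by nlinarith
  have hB0 : 0 ≤ ((L : ℝ) ^ 3 * β) := by linarith
  have hBB₀ : B₀ ≤ ((L : ℝ) ^ 3 * β) := hβB.trans hBβ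
  have hBr : 2 / rStar ^ 3 ≤ ((L : ℝ) ^ 3 * β) := by
    have hr0 : 0 ≤ 2 / rStar ^ 3 := by have := rStar_pos; positivity
    nlinarith
  -- the amplitude support in the two windows
  have hφs14 : ∀ u, φ u ≠ 0 → orbitDist u ≤ 14 * powScale (1 / 6) β := fun u hu => by
    have h := (hφs u hu).le
    have hδ : D * recordDelta1 L (1 / 6) β ≤ 14 * powScale (1 / 6) β := by
      unfold recordDelta1
      rw [mul_div_assoc']
      rw [div_le_iff₀ hN]
      nlinarith [powScale_pos (1 / 6) β]
    exact h.trans hδ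
  -- positivity of the record constants at `β`
  have hK1p : 0 < transferKernel su2Rep ((L : ℝ) ^ 3 * β) (1 : GaugeConfig 3 1 SU2) 1 := transferKernel_pos su2Rep _ _ _
  have hZ : 0 < fpZ (powScale 1 β) := fpZ_pos (powScale_pos 1 β)
  have hZi : 0 < (fpZ (powScale 1 β))⁻¹ := inv_pos.2 hZ
  have hNbar : 0 < fpWeightBar L (powScale 1 β) := fpWeightBar_pos L (powScale_pos 1 β)
  have hI0 := slowWindow_I0_pos (L := L) (powScale_pos (1 / 3) β) (powScale_pos (1 / 2) β) ((L : ℝ) ^ 3 * β)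
  obtain ⟨hSlo, -⟩ := stiffGaussTop_record_bounds (L := L) hβ0
  have hS : 0 < stiffGaussTop L (β / 2) β := lt_of_lt_of_le (pow_pos (Real.sqrt_pos.2 (by positivity)) _) hSlo
  have ha₀' : 0 ≤ stiffGaussTop L (β / 2) β / (∫ u, ({u : GaugeConfig 3 1 SU2 | (∀ k : Fin 3, ‖su2Quat (u (0, k)) - 1‖ ≤ (powScale (1 / 3) β)) ∧ (L : ℝ) ^ 3 * wilsonAction su2Rep u ≤ (powScale (1 / 2) β)}.indicator (fun _ => (1 : ℝ))) u * (transferKernel su2Rep ((L : ℝ) ^ 3 * β) (1 : GaugeConfig 3 1 SU2) u / transferKernel su2Rep ((L : ℝ) ^ 3 * β) (1 : GaugeConfig 3 1 SU2) 1) ∂configMeasure SU2 1) := (div_pos hS hI0).le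
  have hA : 0 ≤ c₁ β * (stiffGaussTop L (β / 2) β / (∫ u, ({u : GaugeConfig 3 1 SU2 | (∀ k : Fin 3, ‖su2Quat (u (0, k)) - 1‖ ≤ (powScale (1 / 3) β)) ∧ (L : ℝ) ^ 3 * wilsonAction su2Rep u ≤ (powScale (1 / 2) β)}.indicator (fun _ => (1 : ℝ))) u * (transferKernel su2Rep ((L : ℝ) ^ 3 * β) (1 : GaugeConfig 3 1 SU2) u / transferKernel su2Rep ((L : ℝ) ^ 3 * β) (1 : GaugeConfig 3 1 SU2) 1) ∂configMeasure SU2 1)) := mul_nonneg hc₁.le ha₀'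
  have hM2p : 0 < ∫ v, {v : Edge 3 L → Fin 3 → ℝ | ‖linkEmbed L v‖ ≤ ((min (1 / 40) (powScale (1 / 2) β * btLog β)) / 12)}.indicator (fun _ => (1 : ℝ)) v * (Real.exp (-(stiffGaussExp L (β / 2) β (linkEmbed L v))) ^ 2 * Real.exp (-(‖(gaugeModes L).starProjection (linkEmbed L v)‖ ^ 2 / powScale 1 β ^ 2))) ∂orthoTransverse L := lt_of_lt_of_le (mul_pos (mul_pos (Real.exp_pos _) (pow_pos (by positivity) _)) (pow_pos (powScale_pos 1 β) _)) hM2fl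
  have hγp : 0 < recordGamma L (recordProfile L) β := recordGamma_recordProfile_pos L hβ0.le
  have hℓ0 : 0 ≤ linkCE ((L : ℝ) ^ 3 * β) := (linkCE_pos hB0).le
  have hφ2 : 0 ≤ ∫ w, φ w ^ 2 ∂configMeasure SU2 1 := integral_nonneg fun w => sq_nonneg _
  have hψ2 : 0 ≤ ∫ u, orbitDist u ^ 2 * φ u ^ 2 ∂configMeasure SU2 1 := integral_nonneg fun u => mul_nonneg (sq_nonneg _) (sq_nonneg _)
  have hκP0 : 0 ≤ Cp * ((42 * D + 1) * powScale (1 / 6) β) ^ 2 := by positivity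
  have hη1 : η β < 1 := by linarith
  have hx0 : 0 < powScale (1 / 2) β := powScale_pos _ _
  have hℓ0' : 0 ≤ btLog β := le_trans zero_le_one (one_le_btLog β)
  have hrf0 : 0 ≤ (min (1 / 40) (powScale (1 / 2) β * btLog β)) := le_min (by norm_num) (mul_nonneg hx0.le hℓ0')
  have hRin : (min (1 / 40) (powScale (1 / 2) β * btLog β)) / 12 ≤ (min (1 / 40) (powScale (1 / 2) β * btLog β)) := div_le_self hrf0 (by norm_num)
  have hw : 0 < powScale (2 / 3) β := powScale_pos _ _
  have hw1 : powScale (2 / 3) β ≤ 1 := powScale_le_one (by norm_num) β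
  have hweq : powScale (2 / 3) β = β ^ (-(2 / 3 : ℝ)) := powScale_eq hβ1
  -- (0) the integrated core `L²` estimate with moment data
  have h0 := hcoreβ φ hφm Cφ hφb hφs14
  -- (A) the eight fibre factors
  have hqfm : ∀ β', Measurable ((fun β'' : ℝ => stiffGaussExp L (β'' / 2) β'') β') := fun β' => measurable_stiffGaussExp _ _
  have hqf0 : ∀ β' x, 0 ≤ (fun β'' : ℝ => stiffGaussExp L (β'' / 2) β'') β' x := fun β' x => stiffGaussExp_nonneg _ _ x
  have hΩGm : Measurable (frozenProfile L (fun β' => stiffGaussExp L (β' / 2) β') (fun β' => min (1 / 40) (powScale (1 / 2) β' * btLog β')) β) :=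
    measurable_frozenProfile hqfm _ β
  have hΩG0 : ∀ x, 0 ≤ frozenProfile L (fun β' => stiffGaussExp L (β' / 2) β') (fun β' => min (1 / 40) (powScale (1 / 2) β' * btLog β')) β x :=
    fun x => (frozenProfile_mem_Icc hqf0 _ β x).1
  have hΩG1 : ∀ x, |frozenProfile L (fun β' => stiffGaussExp L (β' / 2) β') (fun β' => min (1 / 40) (powScale (1 / 2) β' * btLog β')) β x| ≤ 1 := abs_frozenProfile_le hqf0 _ β
  have hΩm := measurable_capRestrict (L := L) hΩGm
  have hΩdat := fun x => capRestrict_mem (L := L) hΩG0 hΩG1 x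
  have hΩR : ∀ x : LinkSpace L, (fun x : LinkSpace L => {x : LinkSpace L | linkCurry x ∈ capBalancedSet L}.indicator (fun _ => (1 : ℝ)) x * frozenProfile L (fun β' => stiffGaussExp L (β' / 2) β') (fun β' => min (1 / 40) (powScale (1 / 2) β' * btLog β')) β x) x ≠ 0 → ‖x‖ ≤ (min (1 / 40) (powScale (1 / 2) β * btLog β)) := fun x hx => by
    have h := (capRestrict_frozenProfile_support (L := L) _ _ β (linkCurry x) (by rwa [linkEmbed_linkCurry])).2.2
    rwa [linkEmbed_linkCurry] at h
  have hWm := measurable_coreWeight (L := L) (powScale 1 β) (5 * (powScale (1 / 2) β * btLog β ^ 2))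
  have hΓ0 : 0 ≤ powScale 1 β * (Fintype.card (Site 3 L) : ℝ) := mul_nonneg (powScale_pos _ _).le hN.le
  have hc₂0 : 0 ≤ 300000000 * ((Fintype.card (Edge 3 L) : ℝ) + (Fintype.card (Plaquette 3 L × Fin 3) : ℝ) + (Fintype.card (Plaquette 3 L) : ℝ)) * (β + β * Real.sqrt β / 2) := by positivity
  have hm0 : 0 ≤ Real.sqrt (39 * Real.log ((L : ℝ) ^ 3 * β) / ((L : ℝ) ^ 3 * β)) := Real.sqrt_nonneg _
  have hB := integral_outputWeight_mul_slow_side_le_fibre_factors (L := L) hβ1 (q := fun β' => stiffGaussExp L (β' / 2) β') (measurable_stiffGaussExp (L := L) (β / 2) β)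
    (fun x => stiffGaussExp_nonneg (L := L) (β / 2) β x) (Ω := (fun x : LinkSpace L => {x : LinkSpace L | linkCurry x ∈ capBalancedSet L}.indicator (fun _ => (1 : ℝ)) x * frozenProfile L (fun β' => stiffGaussExp L (β' / 2) β') (fun β' => min (1 / 40) (powScale (1 / 2) β' * btLog β')) β x)) hΩm (fun x => (hΩdat x).2.2) (fun x => (hΩdat x).1) hΩR
    (W := coreWeight L (powScale 1 β) (5 * (powScale (1 / 2) β * btLog β ^ 2))) hWm (abs_coreWeight_le (L := L) _ _) (fun g => (coreWeight_mem_Icc (L := L) _ _ g).1)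
    (dO := DO * powScale (1 / 6) β) (Rin := (min (1 / 40) (powScale (1 / 2) β * btLog β)) / 12) (Γ := (powScale 1 β * Fintype.card (Site 3 L))) (c₂ := 300000000 * ((Fintype.card (Edge 3 L) : ℝ) + (Fintype.card (Plaquette 3 L × Fin 3) : ℝ) + (Fintype.card (Plaquette 3 L) : ℝ)) * (β + β * Real.sqrt β / 2)) (m := Real.sqrt (39 * Real.log ((L : ℝ) ^ 3 * β) / ((L : ℝ) ^ 3 * β))) hΓ0 hc₂0 hm0
    (cq := c₁ β) (a₀' := stiffGaussTop L (β / 2) β / (∫ u, ({u : GaugeConfig 3 1 SU2 | (∀ k : Fin 3, ‖su2Quat (u (0, k)) - 1‖ ≤ (powScale (1 / 3) β)) ∧ (L : ℝ) ^ 3 * wilsonAction su2Rep u ≤ (powScale (1 / 2) β)}.indicator (fun _ => (1 : ℝ))) u * (transferKernel su2Rep ((L : ℝ) ^ 3 * β) (1 : GaugeConfig 3 1 SU2) u / transferKernel su2Rep ((L : ℝ) ^ 3 * β) (1 : GaugeConfig 3 1 SU2) 1) ∂configMeasure SU2 1)) (ηc := η β) hc₁.le ha₀' hη0 hφm hφ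b
  -- the `Γ`-substitution in the coefficients: `216·β·(β⁻¹|Λ|) = 216|Λ|`
  have hβne : β ≠ 0 := hβ0.ne'
  have hQG : 216 * β * (powScale 1 β * (Fintype.card (Site 3 L) : ℝ)) = 216 * (Fintype.card (Site 3 L) : ℝ) := by
    rw [powScale_eq hβ1, Real.rpow_neg_one]; field_simp
  rw [hQG] at hB
  -- (B)/(C) the fibre numbers: seven reference masses and the amplitude mass
  have hF00 : ∫ v, {x : LinkSpace L | linkCurry x ∈ capBalancedSet L}.indicator (fun _ => (1 : ℝ)) (linkEmbed L v) *
          ({x : LinkSpace L | ‖x‖ ≤ (min (1 / 40) (powScale (1 / 2) β * btLog β)) / 12}.indicator (fun _ => (1 : ℝ)) (linkEmbed L v) *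
            (Real.exp (-(stiffGaussExp L (β / 2) β (linkEmbed L v))) * Real.exp (-(‖(gaugeModes L).starProjection (linkEmbed L v)‖ ^ 2 / powScale 1 β ^ 2)))) * (∫ c, fpFibreTransfer L β (fun x : LinkSpace L => {x : LinkSpace L | linkCurry x ∈ capBalancedSet L}.indicator (fun _ => (1 : ℝ)) x * frozenProfile L (fun β' => stiffGaussExp L (β' / 2) β') (fun β' => min (1 / 40) (powScale (1 / 2) β' * btLog β')) β x) (coreWeight L (powScale 1 β) (5 * (powScale (1 / 2) β * btLog β ^ 2))) (gaugeTransform (fun _ : Site 3 L => c⁻¹) (orthoTube L 1 v)) 1 ∂haarProbability SU2) ∂orthoTransverse L ≤ Ξ * fpBOKernel L β (fun x => recordProfile L β x * (1 + β * ‖x‖ ^ 2) ^ 4) (fpWeight L (powScale 1 β)) 1 1 := by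
    have h := hFF β hβ4 hRin (5 * (powScale (1 / 2) β * btLog β ^ 2)) (a := 0) (k := 0) (j := 0) (by norm_num) (by norm_num) (by norm_num)
    simp only [add_zero, pow_zero, mul_one, inv_one, one_mul] at h
    exact h
  have hF02 : ∫ v, {x : LinkSpace L | linkCurry x ∈ capBalancedSet L}.indicator (fun _ => (1 : ℝ)) (linkEmbed L v) *
          ({x : LinkSpace L | ‖x‖ ≤ (min (1 / 40) (powScale (1 / 2) β * btLog β)) / 12}.indicator (fun _ => (1 : ℝ)) (linkEmbed L v) *
            (Real.exp (-(stiffGaussExp L (β / 2) β (linkEmbed L v))) * Real.exp (-(‖(gaugeModes L).starProjection (linkEmbed L v)‖ ^ 2 / powScale 1 β ^ 2)))) * (‖linkEmbed L v‖ ^ 2) ^ 2 * (∫ c, fpFibreTransfer L β (fun x : LinkSpace L => {x : LinkSpace L | linkCurry x ∈ capBalancedSet L}.indicator (fun _ => (1 : ℝ)) x * frozenProfile L (fun β' => stiffGaussExp L (β' / 2) β') (fun β' => min (1 / 40) (powScale (1 / 2) β' * btLog β')) β x) (coreWeight L (powScale 1 β) (5 * (powScale (1 / 2) β * btLog β ^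 2))) (gaugeTransform (fun _ : Site 3 L => c⁻¹) (orthoTube L 1 v)) 1 ∂haarProbability SU2) ∂orthoTransverse L ≤ (β ^ 2)⁻¹ * Ξ * fpBOKernel L β (fun x => recordProfile L β x * (1 + β * ‖x‖ ^ 2) ^ 4) (fpWeight L (powScale 1 β)) 1 1 := by
    have h := hFF β hβ4 hRin (5 * (powScale (1 / 2) β * btLog β ^ 2)) (a := 2) (k := 0) (j := 0) (by norm_num) (by norm_num) (by norm_num)
    simp only [add_zero, pow_zero, mul_one] at h
    exact h
  have hF04 : ∫ v, {x : LinkSpace L | linkCurry x ∈ capBalancedSet L}.indicator (fun _ => (1 : ℝ)) (linkEmbed L v) *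
          ({x : LinkSpace L | ‖x‖ ≤ (min (1 / 40) (powScale (1 / 2) β * btLog β)) / 12}.indicator (fun _ => (1 : ℝ)) (linkEmbed L v) *
            (Real.exp (-(stiffGaussExp L (β / 2) β (linkEmbed L v))) * Real.exp (-(‖(gaugeModes L).starProjection (linkEmbed L v)‖ ^ 2 / powScale 1 β ^ 2)))) * (‖linkEmbed L v‖ ^ 2) ^ 4 * (∫ c, fpFibreTransfer L β (fun x : LinkSpace L => {x : LinkSpace L | linkCurry x ∈ capBalancedSet L}.indicator (fun _ => (1 : ℝ)) x * frozenProfile L (fun β' => stiffGaussExp L (β' / 2) β') (fun β' => min (1 / 40) (powScale (1 / 2) β' * btLog β')) β x) (coreWeight L (powScale 1 β) (5 * (powScale (1 / 2) β * btLog β ^ 2))) (gaugeTransform (fun _ : Site 3 L => c⁻¹) (orthoTube L 1 v)) 1 ∂haarProbability SU2) ∂orthoTransverse L ≤ (β ^ 4)⁻¹ * Ξ * fpBOKernel L β (fun x => recordProfile L β x * (1 + β * ‖x‖ ^ 2) ^ 4) (fpWeight L (powScale 1 β)) 1 1 := by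
    have h := hFF β hβ4 hRin (5 * (powScale (1 / 2) β * btLog β ^ 2)) (a := 4) (k := 0) (j := 0) (by norm_num) (by norm_num) (by norm_num)
    simp only [add_zero, pow_zero, mul_one] at h
    exact h
  have hF1 : ∫ v, {x : LinkSpace L | linkCurry x ∈ capBalancedSet L}.indicator (fun _ => (1 : ℝ)) (linkEmbed L v) *
          ({x : LinkSpace L | ‖x‖ ≤ (min (1 / 40) (powScale (1 / 2) β * btLog β)) / 12}.indicator (fun _ => (1 : ℝ)) (linkEmbed L v) *
            (Real.exp (-(stiffGaussExp L (β / 2) β (linkEmbed L v))) * Real.exp (-(‖(gaugeModes L).starProjection (linkEmbed L v)‖ ^ 2 / powScale 1 β ^ 2)))) * (∫ c, fpFibreTransfer L β (fun x => {x : LinkSpace L | linkCurry x ∈ capBalancedSet L}.indicator (fun _ => (1 : ℝ)) x * frozenProfile L (fun β' => stiffGaussExp L (β' / 2) β') (fun β' => min (1 / 40) (powScale (1 / 2) β' * btLog β')) β x * (‖x‖ ^ 2) ^ 2) (coreWeight L (powScale 1 β) (5 * (powScale (1 / 2) β * btLog β ^ 2))) (gaugeTransform (fun _ : Site 3 L =>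 c⁻¹) (orthoTube L 1 v)) 1 ∂haarProbability SU2) ∂orthoTransverse L ≤ (β ^ 2)⁻¹ * Ξ * fpBOKernel L β (fun x => recordProfile L β x * (1 + β * ‖x‖ ^ 2) ^ 4) (fpWeight L (powScale 1 β)) 1 1 := by
    have h := hFF β hβ4 hRin (5 * (powScale (1 / 2) β * btLog β ^ 2)) (a := 0) (k := 2) (j := 0) (by norm_num) (by norm_num) (by norm_num)
    simp only [add_zero, zero_add, pow_zero, mul_one] at h
    exact h
  have hF2 : ∫ v, {x : LinkSpace L | linkCurry x ∈ capBalancedSet L}.indicator (fun _ => (1 : ℝ)) (linkEmbed L v) *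
          ({x : LinkSpace L | ‖x‖ ≤ (min (1 / 40) (powScale (1 / 2) β * btLog β)) / 12}.indicator (fun _ => (1 : ℝ)) (linkEmbed L v) *
            (Real.exp (-(stiffGaussExp L (β / 2) β (linkEmbed L v))) * Real.exp (-(‖(gaugeModes L).starProjection (linkEmbed L v)‖ ^ 2 / powScale 1 β ^ 2)))) * (∫ c, fpFibreTransfer L β (fun x : LinkSpace L => {x : LinkSpace L | linkCurry x ∈ capBalancedSet L}.indicator (fun _ => (1 : ℝ)) x * frozenProfile L (fun β' => stiffGaussExp L (β' / 2) β') (fun β' => min (1 / 40) (powScale (1 / 2) β' * btLog β')) β x) (fun g => coreWeight L (powScale 1 β) (5 * (powScale (1 / 2) β * btLog β ^ 2)) g * (∑ x, ‖su2Quat (g x) - 1‖ ^ 2) ^ 2) (gaugeTransform (fun _ : Site 3 L => c⁻¹) (orthoTube L 1 v)) 1 ∂haarProbability SU2) ∂orthoTransverse L ≤ (β ^ 2)⁻¹ * Ξ * fpBOKernel L β (fun x => recordProfile L β x * (1 + β * ‖x‖ ^ 2) ^ 4) (fpWeight L (powScale 1 β)) 1 1 := by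
    have h := hFF β hβ4 hRin (5 * (powScale (1 / 2) β * btLog β ^ 2)) (a := 0) (k := 0) (j := 2) (by norm_num) (by norm_num) (by norm_num)
    simp only [add_zero, zero_add, pow_zero, mul_one] at h
    exact h
  have hF3 : ∫ v, {x : LinkSpace L | linkCurry x ∈ capBalancedSet L}.indicator (fun _ => (1 : ℝ)) (linkEmbed L v) *
          ({x : LinkSpace L | ‖x‖ ≤ (min (1 / 40) (powScale (1 / 2) β * btLog β)) / 12}.indicator (fun _ => (1 : ℝ)) (linkEmbed L v) *
            (Real.exp (-(stiffGaussExp L (β / 2) β (linkEmbed L v))) * Real.exp (-(‖(gaugeModes L).starProjection (linkEmbed L v)‖ ^ 2 / powScale 1 β ^ 2)))) * (∫ c, fpFibreTransfer L β (fun x => {x : LinkSpace L | linkCurry x ∈ capBalancedSet L}.indicator (fun _ => (1 : ℝ)) x * frozenProfile L (fun β' => stiffGaussExp L (β' / 2) β') (fun β' => min (1 / 40) (powScale (1 / 2) β' * btLog β')) β x * (‖x‖ ^ 2) ^ 4) (coreWeight L (powScale 1 β) (5 * (powScale (1 / 2) β * btLog β ^ 2))) (gaugeTransform (fun _ : Site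 3 L => c⁻¹) (orthoTube L 1 v)) 1 ∂haarProbability SU2) ∂orthoTransverse L ≤ (β ^ 4)⁻¹ * Ξ * fpBOKernel L β (fun x => recordProfile L β x * (1 + β * ‖x‖ ^ 2) ^ 4) (fpWeight L (powScale 1 β)) 1 1 := by
    have h := hFF β hβ4 hRin (5 * (powScale (1 / 2) β * btLog β ^ 2)) (a := 0) (k := 4) (j := 0) (by norm_num) (by norm_num) (by norm_num)
    simp only [add_zero, zero_add, pow_zero, mul_one] at h
    exact h
  have hF4 : ∫ v, {x : LinkSpace L | linkCurry x ∈ capBalancedSet L}.indicator (fun _ => (1 : ℝ)) (linkEmbed L v) *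
          ({x : LinkSpace L | ‖x‖ ≤ (min (1 / 40) (powScale (1 / 2) β * btLog β)) / 12}.indicator (fun _ => (1 : ℝ)) (linkEmbed L v) *
            (Real.exp (-(stiffGaussExp L (β / 2) β (linkEmbed L v))) * Real.exp (-(‖(gaugeModes L).starProjection (linkEmbed L v)‖ ^ 2 / powScale 1 β ^ 2)))) * (∫ c, fpFibreTransfer L β (fun x : LinkSpace L => {x : LinkSpace L | linkCurry x ∈ capBalancedSet L}.indicator (fun _ => (1 : ℝ)) x * frozenProfile L (fun β' => stiffGaussExp L (β' / 2) β') (fun β' => min (1 / 40) (powScale (1 / 2) β' * btLog β')) β x) (fun g => coreWeight L (powScale 1 β) (5 * (powScale (1 / 2) β * btLog β ^ 2)) g * (∑ x, ‖su2Quat (g x) - 1‖ ^ 2) ^ 4) (gaugeTransform (fun _ : Site 3 L => c⁻¹) (orthoTube L 1 v)) 1 ∂haarProbability SU2) ∂orthoTransverse L ≤ (β ^ 4)⁻¹ * Ξ * fpBOKernel L β (fun x => recordProfile L β x * (1 + β * ‖x‖ ^ 2) ^ 4) (fpWeight L (powScale 1 β)) 1 1 := by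
    have h := hFF β hβ4 hRin (5 * (powScale (1 / 2) β * btLog β ^ 2)) (a := 0) (k := 0) (j := 4) (by norm_num) (by norm_num) (by norm_num)
    simp only [add_zero, zero_add, pow_zero, mul_one] at h
    exact h
  have hFE : ∫ v, {x : LinkSpace L | linkCurry x ∈ capBalancedSet L}.indicator (fun _ => (1 : ℝ)) (linkEmbed L v) *
          ({x : LinkSpace L | ‖x‖ ≤ (min (1 / 40) (powScale (1 / 2) β * btLog β)) / 12}.indicator (fun _ => (1 : ℝ)) (linkEmbed L v) *
            (Real.exp (-(stiffGaussExp L (β / 2) β (linkEmbed L v))) * Real.exp (-(‖(gaugeModes L).starProjection (linkEmbed L v)‖ ^ 2 / powScale 1 β ^ 2)))) * Real.exp (-(stiffGaussExp L (β / 2) β (linkEmbed L v))) ∂orthoTransverse L ≤ ∫ v, {v : Edge 3 L → Fin 3 → ℝ | ‖linkEmbed L v‖ ≤ ((min (1 / 40) (powScale (1 / 2) β * btLog β)) / 12)}.indicator (fun _ => (1 : ℝ)) v * (Real.exp (-(stiffGaussExp L (β / 2) β (linkEmbed L v))) ^ 2 * Real.exp (-(‖(gaugeModes L).starProjection (linkEmbed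 L v)‖ ^ 2 / powScale 1 β ^ 2))) ∂orthoTransverse L := by
    refine integral_mono_of_nonneg (ae_of_all _ fun v => ?_) ?_ (ae_of_all _ fun v => ?_)
    · exact mul_nonneg (capInnerWeight_mem_Icc (L := L) (q := fun β' => stiffGaussExp L (β' / 2) β') (fun x => stiffGaussExp_nonneg (L := L) (β / 2) β x) _ _).1 (Real.exp_nonneg _)
    · refine (integrable_const (1 : ℝ)).mono' ?_ (ae_of_all _ fun v => ?_)
      · exact ((measurable_const.indicator (measurableSet_le (measurable_linkEmbed L).norm measurable_const)).mul
          ((((measurable_stiffGaussExp (L := L) (β / 2) β).comp (measurable_linkEmbed L)).neg.exp.pow_const 2).mul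
            ((((gaugeModes L).starProjection.continuous.measurable.comp (measurable_linkEmbed L)).norm.pow_const 2).div_const _).neg.exp)).aestronglyMeasurable
      · have hg0 : 0 ≤ {v : Edge 3 L → Fin 3 → ℝ | ‖linkEmbed L v‖ ≤ ((min (1 / 40) (powScale (1 / 2) β * btLog β)) / 12)}.indicator (fun _ => (1 : ℝ)) v *
            (Real.exp (-(stiffGaussExp L (β / 2) β (linkEmbed L v))) ^ 2 * Real.exp (-(‖(gaugeModes L).starProjection (linkEmbed L v)‖ ^ 2 / powScale 1 β ^ 2))) :=
          mul_nonneg (Set.indicator_nonneg (fun _ _ => zero_le_one) v) (by positivity)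
        rw [Real.norm_eq_abs, abs_of_nonneg hg0]
        have h1 : {v : Edge 3 L → Fin 3 → ℝ | ‖linkEmbed L v‖ ≤ ((min (1 / 40) (powScale (1 / 2) β * btLog β)) / 12)}.indicator (fun _ => (1 : ℝ)) v ≤ 1 := Set.indicator_le_self' (fun _ _ => zero_le_one) v
        have h0 : 0 ≤ {v : Edge 3 L → Fin 3 → ℝ | ‖linkEmbed L v‖ ≤ ((min (1 / 40) (powScale (1 / 2) β * btLog β)) / 12)}.indicator (fun _ => (1 : ℝ)) v := Set.indicator_nonneg (fun _ _ => zero_le_one) v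
        have h2 : Real.exp (-(stiffGaussExp L (β / 2) β (linkEmbed L v))) ^ 2 ≤ 1 :=
          pow_le_one₀ (Real.exp_nonneg _) (Real.exp_le_one_iff.mpr (by linarith [stiffGaussExp_nonneg (L := L) (β / 2) β (linkEmbed L v)]))
        have h3 : Real.exp (-(‖(gaugeModes L).starProjection (linkEmbed L v)‖ ^ 2 / powScale 1 β ^ 2)) ≤ 1 :=
          Real.exp_le_one_iff.mpr (by have := div_nonneg (sq_nonneg ‖(gaugeModes L).starProjection (linkEmbed L v)‖) (sq_nonneg (powScale 1 β)); linarith)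
        calc _ ≤ 1 * (1 * 1) := mul_le_mul h1 (mul_le_mul h2 h3 (Real.exp_nonneg _) zero_le_one) (by positivity) zero_le_one
          _ = 1 := by ring
    · -- pointwise `Ω₁(x)·e^{-q} ≤ 𝟙_in·(e^{-q})²·e^{-P}`
      dsimp only
      by_cases hv : ‖linkEmbed L v‖ ≤ (min (1 / 40) (powScale (1 / 2) β * btLog β)) / 12
      · have e1 : {x : LinkSpace L | ‖x‖ ≤ (min (1 / 40) (powScale (1 / 2) β * btLog β)) / 12}.indicator (fun _ => (1 : ℝ)) (linkEmbed L v) = 1 :=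
          Set.indicator_of_mem (show linkEmbed L v ∈ {x : LinkSpace L | ‖x‖ ≤ (min (1 / 40) (powScale (1 / 2) β * btLog β)) / 12} from hv) _
        have e2 : {v : Edge 3 L → Fin 3 → ℝ | ‖linkEmbed L v‖ ≤ ((min (1 / 40) (powScale (1 / 2) β * btLog β)) / 12)}.indicator (fun _ => (1 : ℝ)) v = 1 :=
          Set.indicator_of_mem (show v ∈ {v : Edge 3 L → Fin 3 → ℝ | ‖linkEmbed L v‖ ≤ ((min (1 / 40) (powScale (1 / 2) β * btLog β)) / 12)} from hv) _
        rw [e1, e2]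
        have hc : {x : LinkSpace L | linkCurry x ∈ capBalancedSet L}.indicator (fun _ => (1 : ℝ)) (linkEmbed L v) ≤ 1 := Set.indicator_le_self' (fun _ _ => zero_le_one) _
        have hc0 : 0 ≤ {x : LinkSpace L | linkCurry x ∈ capBalancedSet L}.indicator (fun _ => (1 : ℝ)) (linkEmbed L v) := Set.indicator_nonneg (fun _ _ => zero_le_one) _
        have hp : 0 ≤ Real.exp (-(stiffGaussExp L (β / 2) β (linkEmbed L v))) * Real.exp (-(‖(gaugeModes L).starProjection (linkEmbed L v)‖ ^ 2 / powScale 1 β ^ 2)) *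
            Real.exp (-(stiffGaussExp L (β / 2) β (linkEmbed L v))) := by positivity
        nlinarith [hp]
      · have e1 : {x : LinkSpace L | ‖x‖ ≤ (min (1 / 40) (powScale (1 / 2) β * btLog β)) / 12}.indicator (fun _ => (1 : ℝ)) (linkEmbed L v) = 0 :=
          Set.indicator_of_notMem (show linkEmbed L v ∉ {x : LinkSpace L | ‖x‖ ≤ (min (1 / 40) (powScale (1 / 2) β * btLog β)) / 12} from hv) _
        have e2 : {v : Edge 3 L → Fin 3 → ℝ | ‖linkEmbed L v‖ ≤ ((min (1 / 40) (powScale (1 / 2) β * btLog β)) / 12)}.indicator (fun _ => (1 : ℝ)) v = 0 :=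
          Set.indicator_of_notMem (show v ∉ {v : Edge 3 L → Fin 3 → ℝ | ‖linkEmbed L v‖ ≤ ((min (1 / 40) (powScale (1 / 2) β * btLog β)) / 12)} from hv) _
        rw [e1, e2]; simp
  have hRP0 : 0 ≤ fpBOKernel L β (fun x => recordProfile L β x * (1 + β * ‖x‖ ^ 2) ^ 4) (fpWeight L (powScale 1 β)) 1 1 := by
    obtain ⟨hPm, hP01, hPabs, -⟩ := recordProfile_fields L
    have hPt : ∀ v : Edge 3 L → Fin 3 → ℝ, recordProfile L β (linkEmbed L v) ≠ 0 → v ∈ capBalancedSet L ∧ ‖linkEmbed L v‖ ≤ min (1 / 40) (powScale (1 / 2) β * btLog β) :=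
      fun v hv => ⟨(recordProfile_support L hv).1, (recordProfile_support L hv).2.2⟩
    obtain ⟨hΩ'm, hΩ'0, hΩ'b, -⟩ := reweight_props (L := L) hβ0.le (hPm β) (hPabs β) (fun x => (hP01 β x).1) hPt 4
    exact fpBOKernel_nonneg β hΩ'm hΩ'b hΩ'0 (measurable_fpWeight L (powScale 1 β)) (abs_fpWeight_le L (powScale 1 β)) (fun g => (fpWeight_mem_Icc L (powScale 1 β) g).1) 1 1
  have hRR' := hRR β hβ6
  -- (B) the small slow quantities
  have hCB : (4 * (Fintype.card (Edge 3 1) : ℝ)) ^ 2 * crossBound 1 ((L : ℝ) ^ 3 * β) (Real.sqrt (39 * Real.log ((L : ℝ) ^ 3 * β) / ((L : ℝ) ^ 3 * β))) ≤ (288000 * Real.exp 3) * powScale (2 / 3) β * linkCE ((L : ℝ) ^ 3 * β) := by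
    have h := crossBound_log_le_linkCE hB1 hBr
    have hp : ((L : ℝ) ^ 3 * β) ^ (-(2 : ℝ)) ≤ powScale (2 / 3) β := by
      rw [hweq]
      calc ((L : ℝ) ^ 3 * β) ^ (-(2 : ℝ)) ≤ ((L : ℝ) ^ 3 * β) ^ (-(2 / 3 : ℝ)) := Real.rpow_le_rpow_of_exponent_le hB1 (by norm_num)
        _ ≤ β ^ (-(2 / 3 : ℝ)) := Real.rpow_le_rpow_of_nonpos hβ0 hBβ (by norm_num)
    exact h.trans (mul_le_mul_of_nonneg_right (mul_le_mul_of_nonneg_left hp (by positivity)) hℓ0)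
  have hCB0 : 0 ≤ (4 * (Fintype.card (Edge 3 1) : ℝ)) ^ 2 * crossBound 1 ((L : ℝ) ^ 3 * β) (Real.sqrt (39 * Real.log ((L : ℝ) ^ 3 * β) / ((L : ℝ) ^ 3 * β))) := mul_nonneg (sq_nonneg _) (crossBound_pos (L := 1) _ _).le
  have hmsq : (Real.sqrt (39 * Real.log ((L : ℝ) ^ 3 * β) / ((L : ℝ) ^ 3 * β))) ^ 2 ≤ 117 * powScale (2 / 3) β := by
    have h := log_window_sq_le hB1
    have hp : ((L : ℝ) ^ 3 * β) ^ (-(2 / 3 : ℝ)) ≤ powScale (2 / 3) β := by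
      rw [hweq]; exact Real.rpow_le_rpow_of_nonpos hβ0 hBβ (by norm_num)
    exact h.trans (mul_le_mul_of_nonneg_left hp (by norm_num))
  have hdO : (DO * powScale (1 / 6) β) ^ 2 ≤ DO ^ 2 := by
    rw [mul_pow]
    have h1 : powScale (1 / 6) β ^ 2 ≤ 1 := pow_le_one₀ (powScale_pos _ _).le (powScale_le_one (by norm_num) β)
    exact mul_le_of_le_one_right (sq_nonneg DO) h1
  have hβw : β⁻¹ ≤ powScale (2 / 3) β := by
    rw [hweq, ← Real.rpow_neg_one]
    exact Real.rpow_le_rpow_of_exponent_le hβ1 (by norm_num)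
  have hc₂ : (300000000 * ((Fintype.card (Edge 3 L) : ℝ) + (Fintype.card (Plaquette 3 L × Fin 3) : ℝ) + (Fintype.card (Plaquette 3 L) : ℝ)) * (β + β * Real.sqrt β / 2)) ^ 2 ≤ 4 * (300000000 * ((Fintype.card (Edge 3 L) : ℝ) + (Fintype.card (Plaquette 3 L × Fin 3) : ℝ) + (Fintype.card (Plaquette 3 L) : ℝ))) ^ 2 * β ^ 3 := by
    have hs1 : 1 ≤ Real.sqrt β := by rw [← Real.sqrt_one]; exact Real.sqrt_le_sqrt hβ1
    have hs2 : Real.sqrt β ^ 2 = β := Real.sq_sqrt hβ0.le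
    have hββ : β ≤ β * Real.sqrt β := le_mul_of_one_le_right hβ0.le hs1
    have h1 : β + β * Real.sqrt β / 2 ≤ 2 * (β * Real.sqrt β) := by linarith [mul_nonneg hβ0.le (Real.sqrt_nonneg β)]
    have h0 : 0 ≤ β + β * Real.sqrt β / 2 := by positivity
    have h2 : (β + β * Real.sqrt β / 2) ^ 2 ≤ (2 * (β * Real.sqrt β)) ^ 2 := pow_le_pow_left₀ h0 h1 2
    have h3 : (2 * (β * Real.sqrt β)) ^ 2 = 4 * β ^ 3 := by rw [mul_pow, mul_pow, hs2]; ring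
    rw [mul_pow]
    calc (300000000 * ((Fintype.card (Edge 3 L) : ℝ) + (Fintype.card (Plaquette 3 L × Fin 3) : ℝ) + (Fintype.card (Plaquette 3 L) : ℝ))) ^ 2 * (β + β * Real.sqrt β / 2) ^ 2 ≤ (300000000 * ((Fintype.card (Edge 3 L) : ℝ) + (Fintype.card (Plaquette 3 L × Fin 3) : ℝ) + (Fintype.card (Plaquette 3 L) : ℝ))) ^ 2 * (2 * (β * Real.sqrt β)) ^ 2 := mul_le_mul_of_nonneg_left h2 (sq_nonneg _)
      _ = 4 * (300000000 * ((Fintype.card (Edge 3 L) : ℝ) + (Fintype.card (Plaquette 3 L × Fin 3) : ℝ) + (Fintype.card (Plaquette 3 L) : ℝ))) ^ 2 * β ^ 3 := by rw [h3]; ring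
  have hΦ := slow_coeff_bound_phi (KN := 300000000 * ((Fintype.card (Edge 3 L) : ℝ) + (Fintype.card (Plaquette 3 L × Fin 3) : ℝ) + (Fintype.card (Plaquette 3 L) : ℝ))) (AL := 4 + Real.sqrt (8 * (Fintype.card (Plaquette 3 1) : ℝ) * (L : ℝ) ^ 3)) (QG := 216 * (Fintype.card (Site 3 L) : ℝ)) hβ1 hℓ0 hCB0 hCB (by positivity) hmsq (by norm_num) hdO (sq_nonneg DO) hw hw1 hβw hc₂
  have hΨ := slow_coeff_bound_psi (KN := 300000000 * ((Fintype.card (Edge 3 L) : ℝ) + (Fintype.card (Plaquette 3 L × Fin 3) : ℝ) + (Fintype.card (Plaquette 3 L) : ℝ))) (AL := 4 + Real.sqrt (8 * (Fintype.card (Plaquette 3 1) : ℝ) * (L : ℝ) ^ 3)) (QG := 216 * (Fintype.card (Site 3 L) : ℝ)) (dO := DO * powScale (1 / 6) β) hβ1 hℓ0 hCB (by positivity) hmsq (by norm_num) hdO hw1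
  -- insert the fibre numbers into the split
  have hS := hB.trans (split_rhs_bound (K := transferKernel su2Rep ((L : ℝ) ^ 3 * β) (1 : GaugeConfig 3 1 SU2) 1) (by positivity) (by positivity) (by positivity) (by positivity) (by positivity) (by positivity) (by positivity) (by positivity)
    hφ2 hψ2 hη0 hc₁.le ha₀' hΞ0 hRP0 hℓ0 hw.le (by positivity) (by positivity) hF00 hF02 hF04 hF1 hF2 hF3 hF4 hFE hRR' hΦ hΨ)
  -- (C) the currency
  have hP2 := sq_integral_slowPa_le hB0 hK1p hφm hφb
  have h2 : (1 - η β) * (c₁ β * (stiffGaussTop L (β / 2) β / (∫ u, ({u : GaugeConfig 3 1 SU2 | (∀ k : Fin 3, ‖su2Quat (u (0, k)) - 1‖ ≤ (powScale (1 / 3) β)) ∧ (L : ℝ) ^ 3 * wilsonAction su2Rep u ≤ (powScale (1 / 2) β)}.indicator (fun _ => (1 : ℝ))) u * (transferKernel su2Rep ((L : ℝ) ^ 3 * β) (1 : GaugeConfig 3 1 SU2) u / transferKernel su2Rep ((L : ℝ) ^ 3 * β) (1 : GaugeConfig 3 1 SU2) 1) ∂configMeasure SU2 1))) * (∫ v,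 {v : Edge 3 L → Fin 3 → ℝ | ‖linkEmbed L v‖ ≤ ((min (1 / 40) (powScale (1 / 2) β * btLog β)) / 12)}.indicator (fun _ => (1 : ℝ)) v * (Real.exp (-(stiffGaussExp L (β / 2) β (linkEmbed L v))) ^ 2 * Real.exp (-(‖(gaugeModes L).starProjection (linkEmbed L v)‖ ^ 2 / powScale 1 β ^ 2))) ∂orthoTransverse L) ≤ btC L β (recordProfile L β) (btEps β) (5 * (powScale (1 / 2) β * btLog β ^ 2)) * transferKernel su2Rep ((L : ℝ) ^ 3 * β) (1 : GaugeConfig 3 1 SU2) 1 := by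
    have h := btC_floor_of_quasimode_eta (L := L) hβ0 (c₁ := c₁ β) (ηq := η β) hquasiβ
    rw [show c₁ β * stiffGaussTop L (β / 2) β / (∫ u, ({u : GaugeConfig 3 1 SU2 | (∀ k : Fin 3, ‖su2Quat (u (0, k)) - 1‖ ≤ (powScale (1 / 3) β)) ∧ (L : ℝ) ^ 3 * wilsonAction su2Rep u ≤ (powScale (1 / 2) β)}.indicator (fun _ => (1 : ℝ))) u * (transferKernel su2Rep ((L : ℝ) ^ 3 * β) (1 : GaugeConfig 3 1 SU2) u / transferKernel su2Rep ((L : ℝ) ^ 3 * β) (1 : GaugeConfig 3 1 SU2) 1) ∂configMeasure SU2 1) = c₁ β * (stiffGaussTop L (β / 2) β / (∫ u, ({u : GaugeConfig 3 1 SU2 | (∀ k : Fin 3, ‖su2Quat (u (0, k)) - 1‖ ≤ (powScale (1 / 3) β)) ∧ (L : ℝ) ^ 3 * wilsonAction su2Rep u ≤ (powScale (1 / 2) β)}.indicator (fun _ => (1 : ℝ))) u * (transferKernel su2Rep ((L : ℝ) ^ 3 * β) (1 : GaugeConfig 3 1 SU2) u / transferKernel su2Rep ((L : ℝ) ^ 3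 * β) (1 : GaugeConfig 3 1 SU2) 1) ∂configMeasure SU2 1)) from mul_div_assoc _ _ _] at h
    exact h
  have h3 : (1 - 1 / 2) * recordGamma L (recordProfile L) β * (∫ w, φ w ^ 2 ∂configMeasure SU2 1) ≤ tubeNormSq (softWeight (recordChi L (1 / 6) (42 * D + 1) M β)) (boFun L φ (recordProfile L β)) := by
    rw [show (1 - 1 / 2 : ℝ) = 1 / 2 by norm_num]; exact hno φ hφm Cφ hφb hφs
  have h5 := hCE ((L : ℝ) ^ 3 * β) hBB₀
  have hfin := core_currency_pot (T := tubeNormSq (softWeight (recordChi L (1 / 6) (42 * D + 1) M β)) (boFun L φ (recordProfile L β))) hZi hA hNbar hM2p hK1p hℓ0 hφ2 hψ2 hη1 hκP0 hκP1 (by norm_num : (1 / 2 : ℝ) < 1) hγp (by positivity) (by positivity) (by positivity)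
    h0 hS hP2 h2 h3 hγ2 h5
  -- the β-independent constants
  have hκPw : (Cp * ((42 * D + 1) * powScale (1 / 6) β) ^ 2) ^ 2 ≤ Cp ^ 2 * (42 * D + 1) ^ 4 * powScale (2 / 3) β := by
    have e : (Cp * ((42 * D + 1) * powScale (1 / 6) β) ^ 2) ^ 2 = Cp ^ 2 * (42 * D + 1) ^ 4 * (powScale (1 / 6) β ^ 2) ^ 2 := by ring
    have hp4 : (powScale (1 / 6) β ^ 2) ^ 2 = powScale (2 / 3) β := by
      rw [pow_two, pow_two, powScale_mul_powScale, powScale_mul_powScale]; norm_num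
    rw [e, hp4]
  have hT0 : 0 ≤ tubeNormSq (softWeight (recordChi L (1 / 6) (42 * D + 1) M β)) (boFun L φ (recordProfile L β)) := tubeNormSq_nonneg' (softWeight_recordChi_props (L := L) (1 / 6) (42 * D + 1) M β).2.2.1 _
  have hrate := core_rate_consts_le (T := tubeNormSq (softWeight (recordChi L (1 / 6) (42 * D + 1) M β)) (boFun L φ (recordProfile L β))) (γψ := recordGamma L (recordProfile L) β * (∫ u, orbitDist u ^ 2 * φ u ^ 2 ∂configMeasure SU2 1)) hη0 hη2 hκP2 hΞ0 hCr0 (by positivity : (0 : ℝ) ≤ (44 * (4 + Real.sqrt (8 * (Fintype.card (Plaquette 3 1) : ℝ) * (L : ℝ) ^ 3)) ^ 2 * (300000000 * ((Fintype.card (Edge 3 L) : ℝ) + (Fintype.card (Plaquette 3 L × Fin 3) : ℝ) + (Fintype.card (Plaquette 3 L) : ℝ))) ^ 2 * (288000 * Real.exp 3) + 88 * (4 + Real.sqrt (8 * (Fintype.card (Plaquette 3 1) : ℝ) * (L : ℝ) ^ 3)) ^ 2 * (300000000 * ((Fintype.card (Edge 3 L) : ℝ) + (Fintype.card (Plaquette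 3 L × Fin 3) : ℝ) + (Fintype.card (Plaquette 3 L) : ℝ))) ^ 2 * 117 + 14 * (216 * (Fintype.card (Site 3 L) : ℝ)) ^ 2 * DO ^ 2 * (288000 * Real.exp 3) + 16 * (216 * (Fintype.card (Site 3 L) : ℝ)) ^ 2 * (288000 * Real.exp 3) * 117 + 4 * (216 * (Fintype.card (Site 3 L) : ℝ)) ^ 2 * (288000 * Real.exp 3) ^ 2 + 5 * (300000000 * ((Fintype.card (Edge 3 L) : ℝ) + (Fintype.card (Plaquette 3 L × Fin 3) : ℝ) + (Fintype.card (Plaquette 3 L) : ℝ))) ^ 2 + 28 * (216 * (Fintype.card (Site 3 L) : ℝ)) ^ 2 * DO ^ 2 * 117 + 16 * (216 * (Fintype.card (Site 3 L) : ℝ)) ^ 2 * 117 ^ 2 + 360 * (300000000 * ((Fintype.card (Edge 3 L) : ℝ) + (Fintype.card (Plaquette 3 L × Fin 3) : ℝ) + (Fintype.card (Plaquette 3 L) : ℝ))) ^ 2)) (by positivity : (0 : ℝ) ≤ (72 * (4 + Real.sqrt (8 * (Fintype.card (Plaquette 3 1) : ℝ) * (L : ℝ) ^ 3)) ^ 2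 * (300000000 * ((Fintype.card (Edge 3 L) : ℝ) + (Fintype.card (Plaquette 3 L × Fin 3) : ℝ) + (Fintype.card (Plaquette 3 L) : ℝ))) ^ 2 + 8 * (216 * (Fintype.card (Site 3 L) : ℝ)) ^ 2 * (288000 * Real.exp 3) + 28 * (216 * (Fintype.card (Site 3 L) : ℝ)) ^ 2 * DO ^ 2 + 16 * (216 * (Fintype.card (Site 3 L) : ℝ)) ^ 2 * 117)) hw.le hκPw hT0
    (mul_nonneg hγp.le hψ2)
  have hΛe : btC L β (recordProfile L β) (btEps β) (5 * (powScale (1 / 2) β * btLog β ^ 2)) * (fpZ (powScale 1 β))⁻¹ / recordGamma L (recordProfile L) β * levelValue su2Rep 1 ((L : ℝ) ^ 3 * β) 0 = btC L β (recordProfile L β) (btEps β) (5 * (powScale (1 / 2) β * btLog β ^ 2)) / fpZ (btEps β) / recordGamma L (recordProfile L) β * levelValue su2Rep 1 ((L : ℝ) ^ 3 * β) 0 := sigma_forms_eq _ _ _ _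
  rw [← hΛe]
  exact hfin.trans (mul_le_mul_of_nonneg_left hrate (sq_nonneg _))

end Summit.QuantumFields.YangMills.Theorems.FemtoTransferGap.TwoLattice.ConstTube

end
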